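import Summits.ResolutionOfSingularities.ResolutionOfSingularities.Theorems.ValuativeLupi
import Summits.ResolutionOfSingularities.ResolutionOfSingularities.Theorems.ValuativeLupiConstantField
import HarnessLib

/-!
# Route `Valuative`, item `Lupi` (stmt-ResolutionOfSingularities-0560): the binomial case `t ^ p = c · xᵃ`

`Lupi` asks for local uniformization of every valuation ring `O ⊇ k` of the function field
`K = k(x₁, …, xₙ, t)`, `t ^ p ∈ k[x]`, of the Zariski hypersurface `t ^ p = f(x)`.  This file
settles, UNCONDITIONALLY, in every dimension `n`, for every prime `p`, every ground field `k`
and every valuation ring `O`, the case where `f` is a MONOMIAL up to a constant and a `p`-th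
power:

* `isLocallyUniformizable_of_pow_eq_monomial` — `t ^ p = c · ∏ xᵢ ^ aᵢ` (`c ∈ k`, `a ∈ ℕⁿ`; any
  characteristic of `k`);
* `isLocallyUniformizable_of_pow_eq_monomial_add_pow` — `t ^ p = c · ∏ xᵢ ^ aᵢ + g ^ p` with
  `g ∈ k(x)` (`char k = p`: replace `t` by `t - g`);
* `lupi_monomial` — the same in the binder shape of the item;

and, by the same mechanism, the LINEAR case `t ^ p = x_{i₀} · g + h` (`g ≠ 0`, `g, h` free of
`x_{i₀}`; any exponent `p ≠ 0`): `isLocallyUniformizable_of_pow_eq_linear`.  Both rest on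
`isLocallyUniformizable_of_adjoin_range_eq_top`: a function field GENERATED by `trdeg`-many
elements is locally uniformizable along every valuation ring (Laurent base).

The point (classical, toric): the binomial hypersurface `t ^ p = c · xᵃ` is RATIONAL.  If
`p ∤ a_{i₀}`, Bézout `a_{i₀} u = p v + 1` gives the birational change of coordinates
`y_{i₀} := t ^ u / x_{i₀} ^ v`, `yᵢ := xᵢ (i ≠ i₀)` with `k(y) = K`
(`exists_adjoin_range_eq_top_of_pow_eq_monomial`: `x_{i₀} = y_{i₀} ^ p / (c ^ u ∏_{i ≠ i₀} xᵢ ^ {aᵢ u})`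
and `t = (y_{i₀} x_{i₀} ^ v) ^ {a_{i₀}} / (t ^ p) ^ v`), so `y` is a transcendence basis
GENERATING `K` and the Laurent base `k[yᵢ^{±1}] ⊆ O` of `ValuativeLupiLaurentBase` is a regular
affine model along any `O` (`isLocallyUniformizable_of_adjoin_range_eq_top`); if `p ∣ a`, then
`(t / x^{a/p}) ^ p = c ∈ k` is the constant case of `ValuativeLupiConstantField`; `c = 0` is the
rational case `t = 0`.

So a counterexample to `Lupi` needs `f` to be neither a `p`-th power, nor a constant, nor a
monomial modulo `p`-th powers (on top of `n ≥ 4` and a non-Abhyankar `O`: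
`ValuativeLupi.lean`, `ValuativeLupiAbhyankarPlaces.lean`).

Log: (1) direct, elementary field arithmetic over `ValuativeLupiLaurentBase` /
`ValuativeLupi` / `ValuativeLupiConstantField`.
-/

-- single-problem summit: the doubled namespace component `ResolutionOfSingularities` is forced
set_option linter.dupNamespace false

open IsLocalRing

namespace Summit.ResolutionOfSingularities.ResolutionOfSingularities.Theorems.Lupi

open Literature.AlgebraicGeometry.Resolution

variable {k K : Type} [Field k] [Field K] [Algebra k K]

/-! ## Field arithmetic: twisting the last generator -/

/-- Twisting the last generator by a nonzero element of `k(S)` keeps `k(S, t) = K`. -/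
theorem adjoin_insert_mul_eq_top {S : Set K} {t s : K}
    (hs : s ∈ IntermediateField.adjoin k S) (hs0 : s ≠ 0)
    (htop : IntermediateField.adjoin k (insert t S) = ⊤) :
    IntermediateField.adjoin k (insert (t * s) S) = ⊤ := by
  apply top_le_iff.mp
  rw [← htop, IntermediateField.adjoin_le_iff]
  have hSF : IntermediateField.adjoin k S ≤ IntermediateField.adjoin k (insert (t * s) S) :=
    IntermediateField.adjoin.mono k _ _ (Set.subset_insert _ _)
  have htsF : t * s ∈ IntermediateField.adjoin k (insert (t * s) S) :=
    IntermediateField.subset_adjoin k _ (Set.mem_insert _ _)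
  rintro z (rfl | hz)
  · have hz : z * s * s⁻¹ ∈ IntermediateField.adjoin k (insert (z * s) S) :=
      mul_mem htsF (inv_mem (hSF hs))
    rwa [mul_assoc, mul_inv_cancel₀ hs0, mul_one] at hz
  · exact hSF (IntermediateField.subset_adjoin k S hz)

/-- Translating the last generator by an element of `k(S)` keeps `k(S, t) = K`. -/
theorem adjoin_insert_sub_eq_top {S : Set K} {t g : K}
    (hg : g ∈ IntermediateField.adjoin k S)
    (htop : IntermediateField.adjoin k (insert t S) = ⊤) :
    IntermediateField.adjoin k (insert (t - g) S) = ⊤ := by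
  apply top_le_iff.mp
  rw [← htop, IntermediateField.adjoin_le_iff]
  have hSF : IntermediateField.adjoin k S ≤ IntermediateField.adjoin k (insert (t - g) S) :=
    IntermediateField.adjoin.mono k _ _ (Set.subset_insert _ _)
  have htgF : t - g ∈ IntermediateField.adjoin k (insert (t - g) S) :=
    IntermediateField.subset_adjoin k _ (Set.mem_insert _ _)
  rintro z (rfl | hz)
  · have hz : z - g + g ∈ IntermediateField.adjoin k (insert (z - g) S) := add_mem htgF (hSF hg)
    rwa [sub_add_cancel] at hz
  · exact hSF (IntermediateField.subset_adjoin k S hz)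

/-! ## Purely transcendental function fields with a generating transcendence basis -/

/-- **`K = k(y₁, …, yₙ)` with `n ≤ trdeg_k K` is locally uniformizable along every valuation ring
`O ⊇ k`**: `y` is then algebraically independent (Mathlib's
`isTranscendenceBasis_of_le_trdeg_of_finite`) and the Laurent base `k[yᵢ^{±1} ∈ O]` is a regular
affine model (`isLocallyUniformizable_of_mem_adjoin`, the rational case of `ValuativeLupi`). -/
theorem isLocallyUniformizable_of_adjoin_range_eq_top {n : ℕ} (y : Fin n → K)
    (htop : IntermediateField.adjoin k (Set.range y) = ⊤)
    (hn : (n : Cardinal) ≤ Algebra.trdeg k K)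
    (O : ValuationSubring K) (hO : ∀ c : k, algebraMap k K c ∈ O) :
    IsLocallyUniformizable k K O := by
  haveI : FaithfulSMul k K :=
    (faithfulSMul_iff_algebraMap_injective k K).mpr (algebraMap k K).injective
  haveI halg : Algebra.IsAlgebraic (Algebra.adjoin k (Set.range y)) K :=
    ⟨fun a => isAlgebraic_adjoin_of_mem_adjoin (by rw [htop]; exact IntermediateField.mem_top)⟩
  have hy : AlgebraicIndependent k y :=
    (Algebra.IsAlgebraic.isTranscendenceBasis_of_le_trdeg_of_finite k y
      (by rwa [Cardinal.mk_fin])).1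
  have htop1 : IntermediateField.adjoin k (insert (1 : K) (Set.range y)) = ⊤ := by
    apply top_le_iff.mp
    rw [← htop]
    exact IntermediateField.adjoin.mono k _ _ (Set.subset_insert _ _)
  exact isLocallyUniformizable_of_mem_adjoin y 1 one_ne_zero hy
    (by rw [one_pow]; exact one_mem _) htop1 (one_mem _) O hO

/-! ## The linear case `t ^ p = x_{i₀} · g + h` -/

/-- **The linear case of `Lupi`, unconditionally** (every `n`, every exponent `p ≠ 0`, every `k`,
every `O`): if `x` is algebraically independent, `t ^ p = x_{i₀} · g + h` with `g ≠ 0` and `g, h`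
polynomials in the OTHER variables `xᵢ (i ≠ i₀)`, and `K = k(x, t)`, then `O` is locally
uniformizable over `k`: `x_{i₀} = (t ^ p - h) / g`, so `K = k(t, xᵢ (i ≠ i₀))` is rational with
the generating transcendence basis `Function.update x i₀ t`. -/
theorem isLocallyUniformizable_of_pow_eq_linear {n : ℕ} (x : Fin n → K) (t : K) {p : ℕ}
    (hp : p ≠ 0) (hx : AlgebraicIndependent k x) {i₀ : Fin n} {g h : K}
    (hg : g ∈ Algebra.adjoin k (x '' ({i₀}ᶜ : Set (Fin n))))
    (hh : h ∈ Algebra.adjoin k (x '' ({i₀}ᶜ : Set (Fin n)))) (hg0 : g ≠ 0)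
    (ht : t ^ p = x i₀ * g + h)
    (htop : IntermediateField.adjoin k (insert t (Set.range x)) = ⊤)
    (O : ValuationSubring K) (hO : ∀ c : k, algebraMap k K c ∈ O) :
    IsLocallyUniformizable k K O := by
  classical
  have hsub : Algebra.adjoin k (x '' ({i₀}ᶜ : Set (Fin n))) ≤ Algebra.adjoin k (Set.range x) :=
    Algebra.adjoin_mono (Set.image_subset_range _ _)
  have hxi₀A : x i₀ ∈ Algebra.adjoin k (Set.range x) := Algebra.subset_adjoin ⟨i₀, rfl⟩
  have htp : t ^ p ∈ Algebra.adjoin k (Set.range x) := by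
    rw [ht]
    exact add_mem (mul_mem hxi₀A (hsub hg)) (hsub hh)
  set y : Fin n → K := Function.update x i₀ t with hy
  set F := IntermediateField.adjoin k (Set.range y) with hF
  have hyF : ∀ i, y i ∈ F := fun i => IntermediateField.subset_adjoin k _ ⟨i, rfl⟩
  have htF : t ∈ F := by
    have := hyF i₀
    rwa [hy, Function.update_self] at this
  have hxF' : ∀ i, i ≠ i₀ → x i ∈ F := fun i hi => by
    have := hyF i
    rwa [hy, Function.update_of_ne hi] at this
  have hsubF : Algebra.adjoin k (x '' ({i₀}ᶜ : Set (Fin n))) ≤ F.toSubalgebra := by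
    refine Algebra.adjoin_le ?_
    rintro _ ⟨i, hi, rfl⟩
    exact hxF' i hi
  have hgF : g ∈ F := hsubF hg
  have hhF : h ∈ F := hsubF hh
  have hxi₀F : x i₀ ∈ F := by
    have : x i₀ = (t ^ p - h) * g⁻¹ := by
      rw [eq_mul_inv_iff_mul_eq₀ hg0, ht, add_sub_cancel_right]
    rw [this]
    exact mul_mem (sub_mem (pow_mem htF _) hhF) (inv_mem hgF)
  have hxF : ∀ i, x i ∈ F := fun i => by
    rcases eq_or_ne i i₀ with rfl | hi
    · exact hxi₀F
    · exact hxF' i hi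
  have htopy : F = ⊤ := by
    apply top_le_iff.mp
    rw [← htop, IntermediateField.adjoin_le_iff]
    rintro z (rfl | ⟨i, rfl⟩)
    · exact htF
    · exact hxF i
  exact isLocallyUniformizable_of_adjoin_range_eq_top y htopy
    (trdeg_eq x t hp hx htp htop).ge O hO

/-! ## The binomial hypersurface `t ^ p = c · xᵃ` is rational -/

/-- **Rationality of the binomial hypersurface.** If `t ^ p = c · ∏ xᵢ ^ aᵢ` with `c ≠ 0`, all
`xᵢ ≠ 0`, `p` prime NOT dividing `a_{i₀}`, and `K = k(x, t)`, then `K = k(y)` for the family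
`y_{i₀} := t ^ u · (x_{i₀} ^ v)⁻¹`, `yᵢ := xᵢ (i ≠ i₀)`, where `a_{i₀} u = p v + 1` (Bézout). -/
theorem exists_adjoin_range_eq_top_of_pow_eq_monomial {n : ℕ} {x : Fin n → K} {t : K} {p : ℕ}
    (hp : p.Prime) (hx0 : ∀ i, x i ≠ 0) {c : k} (hc : c ≠ 0) {a : Fin n → ℕ} {i₀ : Fin n}
    (hi₀ : ¬ p ∣ a i₀) (ht : t ^ p = algebraMap k K c * ∏ i, x i ^ a i)
    (htop : IntermediateField.adjoin k (insert t (Set.range x)) = ⊤) :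
    ∃ y : Fin n → K, (∀ i, i ≠ i₀ → y i = x i) ∧
      IntermediateField.adjoin k (Set.range y) = ⊤ := by
  classical
  -- Bézout: `a i₀ * u = p * v + 1`
  obtain ⟨u, -, hu⟩ := Nat.exists_mul_mod_eq_one_of_coprime
    ((Nat.Prime.coprime_iff_not_dvd hp).mpr hi₀).symm hp.one_lt
  set v : ℕ := a i₀ * u / p with hv
  have huv : a i₀ * u = p * v + 1 := by
    have h := Nat.div_add_mod (a i₀ * u) p
    rw [hu] at h
    exact h.symm
  set C : K := algebraMap k K c with hC
  have hC0 : C ≠ 0 := (map_ne_zero (algebraMap k K)).mpr hc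
  have hxi₀ : x i₀ ≠ 0 := hx0 i₀
  obtain ⟨M', hM'⟩ : ∃ M' : K, M' = ∏ i ∈ Finset.univ.erase i₀, x i ^ a i := ⟨_, rfl⟩
  have hM'0 : M' ≠ 0 := hM' ▸ Finset.prod_ne_zero_iff.mpr fun i _ => pow_ne_zero _ (hx0 i)
  have hM : ∏ i, x i ^ a i = x i₀ ^ a i₀ * M' := by
    rw [hM']
    exact (Finset.mul_prod_erase Finset.univ (fun i => x i ^ a i) (Finset.mem_univ i₀)).symm
  have htp0 : t ^ p ≠ 0 := by
    rw [ht, hM]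
    exact mul_ne_zero hC0 (mul_ne_zero (pow_ne_zero _ hxi₀) hM'0)
  -- the new coordinates
  obtain ⟨y, hy⟩ :
      ∃ y : Fin n → K, y = fun i => if i = i₀ then t ^ u * (x i₀ ^ v)⁻¹ else x i := ⟨_, rfl⟩
  have hyi₀ : y i₀ = t ^ u * (x i₀ ^ v)⁻¹ := by rw [hy]; simp
  have hyi : ∀ i, i ≠ i₀ → y i = x i := fun i hi => by rw [hy]; simp [hi]
  refine ⟨y, hyi, ?_⟩
  set F := IntermediateField.adjoin k (Set.range y) with hF
  have hyF : ∀ i, y i ∈ F := fun i => IntermediateField.subset_adjoin k _ ⟨i, rfl⟩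
  have hCF : C ∈ F := F.algebraMap_mem c
  have hxF' : ∀ i, i ≠ i₀ → x i ∈ F := fun i hi => hyi i hi ▸ hyF i
  have hM'F : M' ∈ F :=
    hM' ▸ prod_mem fun i hi => pow_mem (hxF' i (Finset.ne_of_mem_erase hi)) _
  -- `y i₀ ^ p = C ^ u * M' ^ u * x i₀`, so `x i₀ ∈ k(y)`
  have hyx : y i₀ * x i₀ ^ v = t ^ u := by
    rw [hyi₀, mul_assoc, inv_mul_cancel₀ (pow_ne_zero _ hxi₀), mul_one]
  have htu : (t ^ u) ^ p = (t ^ p) ^ u := by rw [← pow_mul, mul_comm, pow_mul]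
  have key : y i₀ ^ p = C ^ u * M' ^ u * x i₀ := by
    have h1 : (y i₀ * x i₀ ^ v) ^ p = C ^ u * M' ^ u * x i₀ * (x i₀ ^ v) ^ p := by
      rw [hyx, htu, ht, hM, mul_pow, mul_pow,
        show (x i₀ ^ a i₀) ^ u = x i₀ ^ (p * v + 1) by rw [← pow_mul, huv]]
      ring
    rw [mul_pow] at h1
    exact mul_right_cancel₀ (pow_ne_zero _ (pow_ne_zero _ hxi₀)) h1
  have hxi₀F : x i₀ ∈ F := by
    have hCM : C ^ u * M' ^ u ≠ 0 := mul_ne_zero (pow_ne_zero _ hC0) (pow_ne_zero _ hM'0)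
    have : x i₀ = y i₀ ^ p * (C ^ u * M' ^ u)⁻¹ := by
      rw [key, eq_comm, mul_inv_eq_iff_eq_mul₀ hCM]
      exact mul_comm _ _
    rw [this]
    exact mul_mem (pow_mem (hyF i₀) _) (inv_mem (mul_mem (pow_mem hCF _) (pow_mem hM'F _)))
  have hxF : ∀ i, x i ∈ F := fun i => by
    rcases eq_or_ne i i₀ with rfl | hi
    · exact hxi₀F
    · exact hxF' i hi
  -- `t * (t ^ p) ^ v = (y i₀ * x i₀ ^ v) ^ (a i₀)`, so `t ∈ k(y)`
  have hPF : t ^ p ∈ F := by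
    rw [ht]
    exact mul_mem hCF (prod_mem fun i _ => pow_mem (hxF i) _)
  have key2 : t * (t ^ p) ^ v = (y i₀ * x i₀ ^ v) ^ a i₀ := by
    rw [hyx, ← pow_mul, ← pow_mul, mul_comm u (a i₀), huv, pow_succ]
    exact mul_comm _ _
  have htF : t ∈ F := by
    have : t = (y i₀ * x i₀ ^ v) ^ a i₀ * ((t ^ p) ^ v)⁻¹ := by
      rw [eq_mul_inv_iff_mul_eq₀ (pow_ne_zero _ htp0)]
      exact key2
    rw [this]
    exact mul_mem (pow_mem (mul_mem (hyF i₀) (pow_mem (hxF i₀) _)) _) (inv_mem (pow_mem hPF _))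
  -- hence `k(y) ⊇ k(x, t) = K`
  apply top_le_iff.mp
  rw [← htop, IntermediateField.adjoin_le_iff]
  rintro z (rfl | ⟨i, rfl⟩)
  · exact htF
  · exact hxF i

/-! ## The binomial case of `Lupi` -/

/-- **The binomial case of `Lupi`, unconditionally**: every `n`, every prime `p`, every field `k`
(of any characteristic), every valuation ring `O ⊇ k`.  If `x` is algebraically independent over
`k`, `t ^ p = c · ∏ xᵢ ^ aᵢ` (`c ∈ k`, `a ∈ ℕⁿ`) and `K = k(x, t)`, then `O` is locally
uniformizable over `k`.  Cases: `c = 0` (then `t = 0`, rational case); `p ∣ a` (then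
`(t / x^{a/p}) ^ p = c`, constant case of `ValuativeLupiConstantField`); otherwise `K = k(y)` is
rational by `exists_adjoin_range_eq_top_of_pow_eq_monomial` and `trdeg_k K = n`. -/
theorem isLocallyUniformizable_of_pow_eq_monomial {n : ℕ} (x : Fin n → K) (t : K) {p : ℕ}
    (hp : p.Prime) (hx : AlgebraicIndependent k x) (c : k) (a : Fin n → ℕ)
    (ht : t ^ p = algebraMap k K c * ∏ i, x i ^ a i)
    (htop : IntermediateField.adjoin k (insert t (Set.range x)) = ⊤)
    (O : ValuationSubring K) (hO : ∀ c : k, algebraMap k K c ∈ O) :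
    IsLocallyUniformizable k K O := by
  classical
  have hp0 : p ≠ 0 := hp.ne_zero
  have hxA : ∀ i, x i ∈ Algebra.adjoin k (Set.range x) := fun i => Algebra.subset_adjoin ⟨i, rfl⟩
  have htp : t ^ p ∈ Algebra.adjoin k (Set.range x) := by
    rw [ht]
    exact mul_mem (Subalgebra.algebraMap_mem _ c) (prod_mem fun i _ => pow_mem (hxA i) _)
  by_cases hc : c = 0
  · -- `t = 0`
    refine isLocallyUniformizable_of_mem_adjoin x t hp0 hx htp htop ?_ O hO
    have h0 : t = 0 := (pow_eq_zero_iff hp0).mp (by rw [ht, hc, map_zero, zero_mul])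
    rw [h0]
    exact zero_mem _
  have hx0 : ∀ i, x i ≠ 0 := fun i => hx.ne_zero i
  by_cases hdvd : ∀ i, p ∣ a i
  · -- `p ∣ a`: twist `t` into a `p`-th root of the constant `c`
    set m : K := ∏ i, x i ^ (a i / p) with hm
    have hm0 : m ≠ 0 := Finset.prod_ne_zero_iff.mpr fun i _ => pow_ne_zero _ (hx0 i)
    have hmon0 : (∏ i, x i ^ a i) ≠ 0 :=
      Finset.prod_ne_zero_iff.mpr fun i _ => pow_ne_zero _ (hx0 i)
    have hmp : m ^ p = ∏ i, x i ^ a i := by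
      rw [hm, ← Finset.prod_pow]
      exact Finset.prod_congr rfl fun i _ => by rw [← pow_mul, Nat.div_mul_cancel (hdvd i)]
    have hxF : ∀ i, x i ∈ IntermediateField.adjoin k (Set.range x) := fun i =>
      IntermediateField.subset_adjoin k _ ⟨i, rfl⟩
    have hmF : m⁻¹ ∈ IntermediateField.adjoin k (Set.range x) :=
      inv_mem (prod_mem fun i _ => pow_mem (hxF i) _)
    refine isLocallyUniformizable_of_pow_mem_range x (t * m⁻¹) hp0 hx
      (RingHom.mem_range.mpr ⟨c, ?_⟩) (adjoin_insert_mul_eq_top hmF (inv_ne_zero hm0) htop) O hO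
    rw [mul_pow, inv_pow, hmp, ht, mul_assoc, mul_inv_cancel₀ hmon0, mul_one]
  · -- the live binomial case: `K = k(y)` is rational
    push Not at hdvd
    obtain ⟨i₀, hi₀⟩ := hdvd
    obtain ⟨y, -, hy⟩ := exists_adjoin_range_eq_top_of_pow_eq_monomial hp hx0 hc hi₀ ht htop
    exact isLocallyUniformizable_of_adjoin_range_eq_top y hy
      (trdeg_eq x t hp0 hx htp htop).ge O hO

/-- **The binomial case modulo `p`-th powers** (`char k = p`): if `x` is algebraically independent,
`t ^ p = c · ∏ xᵢ ^ aᵢ + g ^ p` with `g ∈ k(x)` and `K = k(x, t)`, then every valuation ring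
`O ⊇ k` of `K` is locally uniformizable over `k` — replace `t` by `t - g`
(`(t - g) ^ p = t ^ p - g ^ p` in characteristic `p`). -/
theorem isLocallyUniformizable_of_pow_eq_monomial_add_pow {n : ℕ} (x : Fin n → K) (t : K)
    {p : ℕ} (hp : p.Prime) [CharP k p] (hx : AlgebraicIndependent k x) (c : k) (a : Fin n → ℕ)
    {g : K} (hg : g ∈ IntermediateField.adjoin k (Set.range x))
    (ht : t ^ p = algebraMap k K c * ∏ i, x i ^ a i + g ^ p)
    (htop : IntermediateField.adjoin k (insert t (Set.range x)) = ⊤)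
    (O : ValuationSubring K) (hO : ∀ c : k, algebraMap k K c ∈ O) :
    IsLocallyUniformizable k K O := by
  haveI := Fact.mk hp
  haveI : CharP K p := charP_of_injective_algebraMap (algebraMap k K).injective p
  have ht' : (t - g) ^ p = algebraMap k K c * ∏ i, x i ^ a i := by
    rw [sub_pow_char, ht, add_sub_cancel_right]
  exact isLocallyUniformizable_of_pow_eq_monomial x (t - g) hp hx c a ht'
    (adjoin_insert_sub_eq_top hg htop) O hO

/-- `Lupi` restricted to binomial right-hand sides modulo `p`-th powers — `t ^ p = c · xᵃ + g ^ p`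
with `g ∈ k[x]` (so `t ^ p ∈ k[x]`, an instance of the item's hypotheses) — holds outright, in
the item's own binder shape, for every `n`. -/
theorem lupi_monomial : ∀ p : ℕ, p.Prime → ∀ (k K : Type) [Field k] [CharP k p] [Field K]
    [Algebra k K] (n : ℕ) (x : Fin n → K) (t : K) (c : k) (a : Fin n → ℕ) (g : K),
      AlgebraicIndependent k x → g ∈ Algebra.adjoin k (Set.range x) →
      t ^ p = algebraMap k K c * ∏ i, x i ^ a i + g ^ p →
      IntermediateField.adjoin k (insert t (Set.range x)) = ⊤ →
      ∀ O : ValuationSubring K, (∀ c : k, algebraMap k K c ∈ O) →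
        IsLocallyUniformizable k K O :=
  fun _ hp k _ _ _ _ _ _ x t c a _ hx hg ht htop O hO =>
    isLocallyUniformizable_of_pow_eq_monomial_add_pow x t hp hx c a
      (IntermediateField.algebra_adjoin_le_adjoin k _ hg) ht htop O hO

end Summit.ResolutionOfSingularities.ResolutionOfSingularities.Theorems.Lupi
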